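import Summits.CriticalPhenomena.PercolationContinuityZ3.Theorems.Transplant.FKConnectivityAllQCountReweightedDefs
import HarnessLib

/-!
# After `not_additiveGluingCountPos`: the node `AdditiveGluingLogConvexPos` — Kozma–Nitzan additive gluing under every positive
# LOG-CONVEX cluster-count reweighting (the convex cone spanned by the random-cluster weights `q^k`), and its bridge to `AdditiveGluingFKPos`

Definitions file (`--supports stmt-CriticalPhenomena-4575`), FK sub-lane `prim-bschramm-fk-1` (gen 12) of the post-continuity programme;
builds on p205010 (kernel theorem, internal audit signed; external expert review pending).  One `@[conjecture]` node — NOT asserted — and an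
elementary bridge; no sorries; standard axioms.  Nothing here bears on p205010.

WHY THIS NODE.  The lane's question 'for which class of measures do the finite links of the chain hold?' had, since fk-1 g9, the working
answer 'additive gluing holds for EVERY cluster-count reweighting `μ_h ∝ P_w·h(k)`' (`AdditiveGluingCountPos`).  That is FALSE
(`not_additiveGluingCountPos`, fk-1 g12, `…CountReweightedGluingCex.lean`: a 7-vertex weighted graph and the non-decreasing step weight
`h = 1{k ≥ 3} + 10⁻⁶`; adversarial exact census kit j133841).  Every failure found uses near-deterministic edge parameters together with a
weight concentrated on one LEVEL (a log-CONCAVE step), and on every failing cell the random-cluster weights `q^k` (`q` from `10⁻⁶` to `10⁶`),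
`k!`, `2^{k²}`, and mixtures of two random-cluster weights still glue.  The natural surviving class is the set of positive LOG-CONVEX
weights, `h(j+1)² ≤ h(j)h(j+2)`: it is a convex cone, contains every `q^k` (with equality) and therefore every MIXTURE of random-cluster
weights (positive combinations of log-convex sequences are log-convex), and it is the class on which fk-1 g10 found the intermediate links
GEN / AG-loc of the `PercNearOneGluing` chain census-exact.
EVIDENCE (fk-1 g12, kit j134093, adversarial EXACT census, 32 cores, 3,276 s: the same 20,016,000 placements `(G, w, o, b, A)` as the
census that produced the refutation — near-deterministic integer palettes `k/D`, `D ∈ {10, 20, 100, 1000}`, sparse / unicyclic / theta / dense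
graphs on 6–9 vertices, |A| = 2..4 — each tested against 43 LOG-CONVEX weights: `q^k` for `q ∈ {10^{±1}, 10^{±2}, 10^{±3}, 10^{±4}, 10^{±6},
2^{±1}}`, `k!`, `2^{k²}`, `10^{k²}`, the V-shaped `M^{|k−j|}` (`M ∈ {10, 10³, 10⁶}`, every `j`), and two-point FK mixtures `10^{−ak} + 10^{bk}`
(`(a,b) ∈ {(3,3),(6,6),(2,1),(1,2)}`), plus log-CONCAVE controls (level indicators `1{k=j}+10⁻⁶`, steps `1{k≥j}+10⁻⁶`)): **0 failures of additive
gluing for every log-convex weight** (≈ 8.6·10⁸ exact checks), while the census contains 5 placements with a per-level failure of additive gluing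
(all n = 7), on which the log-concave controls fail 7 times.  Memo: bschramm/FROM-fk-1-g12-SLACK-FOURPOINT.md §9.
[cite: KozmaNitzan2024, Conj. 1 (p. 3); Thm. 1 (p. 7)] [cite: Grimmett2006, §1.4 eq. (1.20) (p. 15); §3.9 (pp. 63–65)]
-/

noncomputable section

namespace Summit.CriticalPhenomena.PercolationContinuityZ3.Theorems

namespace FK

open MeasureTheory Set Literature.Probability.LatticeModels Literature.Probability.Percolation
open scoped Classical

/-- **Additive gluing for every positive LOG-CONVEX cluster-count reweighting** on every finite weighted graph: for all `n`, `w`, every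
`h : ℕ → ℝ` with `h > 0` and `h(j+1)² ≤ h(j)·h(j+2)` for all `j`, and all `A, o, b`, `AdditiveGluingUnder (crMeasure w h) A o b`.
CONJECTURE-SHAPED STATEMENT, NOT asserted; replaces the refuted `AdditiveGluingCountPos`.  Contains `FK.AdditiveGluingFKPos`
(`additiveGluingFKPos_of_logConvexPos`). [cite: KozmaNitzan2024, Conj. 1 (p. 3)] [cite: Grimmett2006, §1.4 eq. (1.20) (p. 15); §3.9 (pp. 63–65)] -/
@[conjecture] def AdditiveGluingLogConvexPos : Prop :=
  ∀ (n : ℕ) (w : Sym2 (Fin n) → unitInterval) (h : ℕ → ℝ), (∀ k, 0 < h k) → (∀ j, h (j + 1) * h (j + 1) ≤ h j * h (j + 2)) →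
    ∀ (A : Finset (Fin n)) (o b : Fin n), AdditiveGluingUnder (crMeasure w h) A o b

/-- The random-cluster weight `q^k` is log-convex (with equality). [folklore] -/
theorem pow_logConvex (q : ℝ) (j : ℕ) : q ^ (j + 1) * q ^ (j + 1) ≤ q ^ j * q ^ (j + 2) := by
  rw [← pow_add, ← pow_add]; ring_nf; exact le_rfl

/-- **`AdditiveGluingLogConvexPos → FK.AdditiveGluingFKPos`** (take `h = q^k`, `q > 0`). [cite: KozmaNitzan2024, Conj. 1 (p. 3)]
[cite: Grimmett2006, §1.4 eq. (1.20) (p. 15)] -/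
theorem additiveGluingFKPos_of_logConvexPos (hc : AdditiveGluingLogConvexPos) : AdditiveGluingFKPos := by
  intro q hq n w A o b
  have key := hc n w (fun k => q ^ k) (fun k => pow_pos hq k) (pow_logConvex q) A o b
  rw [crMeasure_pow_eq_rcMeasureW] at key
  exact key

/-- A positive combination of two random-cluster weights, `h(k) = α q₁^k + β q₂^k` (`α, β ≥ 0`, `q₁, q₂ > 0`), is log-convex — so the node
covers MIXTURES of random-cluster measures with common edge parameters (Cauchy–Schwarz: `(αa·ar + βb·bs)² ≤ (αa² + βb²)(αa²r² + βb²s²)` with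
`a = q₁^{j/…}`; written out below for the two-term case). [folklore] -/
theorem mix_pow_logConvex {α β q₁ q₂ : ℝ} (hα : 0 ≤ α) (hβ : 0 ≤ β) (hq₁ : 0 < q₁) (hq₂ : 0 < q₂) (j : ℕ) :
    (α * q₁ ^ (j + 1) + β * q₂ ^ (j + 1)) * (α * q₁ ^ (j + 1) + β * q₂ ^ (j + 1)) ≤
      (α * q₁ ^ j + β * q₂ ^ j) * (α * q₁ ^ (j + 2) + β * q₂ ^ (j + 2)) := by
  have key : 0 ≤ α * β * (q₁ ^ j * q₂ ^ j) * (q₁ - q₂) ^ 2 := by positivity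
  have e : (α * q₁ ^ j + β * q₂ ^ j) * (α * q₁ ^ (j + 2) + β * q₂ ^ (j + 2)) -
      (α * q₁ ^ (j + 1) + β * q₂ ^ (j + 1)) * (α * q₁ ^ (j + 1) + β * q₂ ^ (j + 1)) =
      α * β * (q₁ ^ j * q₂ ^ j) * (q₁ - q₂) ^ 2 := by ring
  linarith [key, e]

end FK

end Summit.CriticalPhenomena.PercolationContinuityZ3.Theorems

end
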